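import Summits.Ventures.HodgeRepro2.T5SU11LegendreShiftedBridge

/-!
# Rodrigues' formula: `2ⁿ n! · P_n = Dⁿ (X² − 1)ⁿ`

From the shifted form `n! · legShift n = (−1)ⁿ Dⁿ(Xⁿ(1 − X)ⁿ)` (`T5SU11LegendreShiftedBridge.rodrigues_legShift`,
Mathlib's Rodrigues formula for `shiftedLegendre`) and the un-shifting `legPoly n = (legShift n) ∘ ((X + 1)/2)`
(`legPoly_eq_legShift_comp`): iterated derivatives commute with affine substitutions up to the factor `aⁿ`
(`iterate_derivative_comp_affine`), and `Xⁿ(1 − X)ⁿ ∘ ((X + 1)/2) = (−1/4)ⁿ (X² − 1)ⁿ` (`pow_mul_one_sub_pow_comp`), so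

  **`2ⁿ n! · legPoly n = Dⁿ (X² − 1)ⁿ`**   (`rodrigues`),   **`P_n(x) = (Dⁿ (X² − 1)ⁿ)(x)/(2ⁿ n!)`**   (`legP_eq_rodrigues`),

the classical Rodrigues formula for the Legendre polynomials of the lane (Bonnet's recursion ⇒ Mathlib's explicit
sum ⇒ Rodrigues). Nothing is claimed about (N).

Blind lane: Mathlib + the HodgeRepro2 prefix only; no sorry; axioms ⊆ {propext, Classical.choice,
Quot.sound}.
-/

namespace Summit.Ventures.HodgeRepro2.T5SU11LegendreRodrigues

open Polynomial
open T5SU11SphericalLegendreAll T5SU11JacobiPhaseLawEven T5SU11LegendreShiftedBridge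

/-- **Iterated derivatives and affine substitution**: `Dⁿ (p ∘ (aX + b)) = aⁿ · (Dⁿ p) ∘ (aX + b)`. -/
theorem iterate_derivative_comp_affine (p : ℝ[X]) (a b : ℝ) (n : ℕ) :
    derivative^[n] (p.comp (C a * X + C b)) = C (a ^ n) * (derivative^[n] p).comp (C a * X + C b) := by
  induction n generalizing p with
  | zero => simp
  | succ n ih =>
    have hd : derivative (C a * X + C b : ℝ[X]) = C a := by simp
    rw [Function.iterate_succ_apply, derivative_comp, hd, iterate_derivative_C_mul, ih,
      Function.iterate_succ_apply, ← mul_assoc, ← C_mul, pow_succ, mul_comm a]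

/-- **`legPoly n = (legShift n) ∘ ((X + 1)/2)`**, the inverse of the shift `X ↦ 2X − 1`. -/
theorem legPoly_eq_legShift_comp (n : ℕ) : legPoly n = (legShift n).comp (C (1 / 2 : ℝ) * X + C (1 / 2)) := by
  rw [legShift, comp_assoc]
  have h : (C (2 : ℝ) * X - C 1).comp (C (1 / 2 : ℝ) * X + C (1 / 2)) = X := by
    apply Polynomial.funext
    intro r
    simp only [eval_comp, eval_sub, eval_mul, eval_add, eval_C, eval_X]
    ring
  rw [h, comp_X]

/-- `Xⁿ(1 − X)ⁿ ∘ ((X + 1)/2) = (−1/4)ⁿ (X² − 1)ⁿ`. -/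
theorem pow_mul_one_sub_pow_comp (n : ℕ) :
    (X ^ n * (1 - X) ^ n : ℝ[X]).comp (C (1 / 2 : ℝ) * X + C (1 / 2))
      = C ((-1 / 4 : ℝ) ^ n) * (X ^ 2 - 1) ^ n := by
  apply Polynomial.funext
  intro r
  simp only [eval_comp, eval_mul, eval_pow, eval_sub, eval_one, eval_X, eval_add, eval_C]
  rw [← mul_pow, ← mul_pow]
  congr 1
  ring

/-- **Rodrigues' formula: `2ⁿ n! · legPoly n = Dⁿ (X² − 1)ⁿ`.** -/
theorem rodrigues (n : ℕ) :
    C ((2 : ℝ) ^ n * n.factorial) * legPoly n = derivative^[n] ((X ^ 2 - 1) ^ n) := by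
  set q : ℝ[X] := C (1 / 2 : ℝ) * X + C (1 / 2) with hq
  -- `(Dⁿ(Xⁿ(1−X)ⁿ)) ∘ q = (−1/2)ⁿ · Dⁿ (X² − 1)ⁿ`
  have h1 : (derivative^[n] (X ^ n * (1 - X) ^ n : ℝ[X])).comp q
      = C ((-1 / 2 : ℝ) ^ n) * derivative^[n] ((X ^ 2 - 1) ^ n) := by
    have h := iterate_derivative_comp_affine (X ^ n * (1 - X) ^ n) (1 / 2) (1 / 2) n
    rw [← hq, pow_mul_one_sub_pow_comp, iterate_derivative_C_mul] at h
    have h2 : (C ((2 : ℝ) ^ n) : ℝ[X]) * C ((1 / 2 : ℝ) ^ n) = 1 := by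
      rw [← C_mul, ← mul_pow]
      norm_num
    calc (derivative^[n] (X ^ n * (1 - X) ^ n : ℝ[X])).comp q
        = (C ((2 : ℝ) ^ n) * C ((1 / 2 : ℝ) ^ n)) * (derivative^[n] (X ^ n * (1 - X) ^ n)).comp q := by
          rw [h2, one_mul]
      _ = C ((2 : ℝ) ^ n) * (C ((1 / 2 : ℝ) ^ n) * (derivative^[n] (X ^ n * (1 - X) ^ n)).comp q) := by ring
      _ = C ((2 : ℝ) ^ n) * (C ((-1 / 4 : ℝ) ^ n) * derivative^[n] ((X ^ 2 - 1) ^ n)) := by rw [← h]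
      _ = C ((-1 / 2 : ℝ) ^ n) * derivative^[n] ((X ^ 2 - 1) ^ n) := by
          rw [← mul_assoc, ← C_mul, ← mul_pow]
          norm_num
  have hc := congrArg (fun r : ℝ[X] => r.comp q) (rodrigues_legShift n)
  simp only [mul_comp, natCast_comp, pow_comp, neg_comp, one_comp] at hc
  rw [← legPoly_eq_legShift_comp, h1] at hc
  have hsq : ((-1 : ℝ[X]) ^ n) * C ((-1 / 2 : ℝ) ^ n) = C ((1 / 2 : ℝ) ^ n) := by
    rw [show ((-1 : ℝ[X]) ^ n) = C ((-1 : ℝ) ^ n) by simp, ← C_mul, ← mul_pow]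
    norm_num
  rw [← mul_assoc, hsq] at hc
  have h3 : (C ((2 : ℝ) ^ n * n.factorial) : ℝ[X]) * legPoly n
      = C ((2 : ℝ) ^ n) * ((n.factorial : ℝ[X]) * legPoly n) := by
    rw [C_mul, mul_assoc]
    congr 2
  rw [h3, hc, ← mul_assoc, ← C_mul, ← mul_pow]
  norm_num

/-- **`P_n(x) = (Dⁿ (X² − 1)ⁿ)(x) / (2ⁿ n!)`.** -/
theorem legP_eq_rodrigues (n : ℕ) (x : ℝ) :
    legP n x = (derivative^[n] ((X ^ 2 - 1) ^ n : ℝ[X])).eval x / ((2 : ℝ) ^ n * n.factorial) := by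
  have h := congrArg (eval x) (rodrigues n)
  rw [eval_mul, eval_C, ← legP_eq_eval] at h
  have hne : ((2 : ℝ) ^ n * n.factorial) ≠ 0 := by positivity
  rw [eq_div_iff hne, mul_comm]
  exact h

end Summit.Ventures.HodgeRepro2.T5SU11LegendreRodrigues
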